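import Summits.QuantumFields.BalabanUV.T4Continuum.Support.NE7PairGlueStep
import Summits.QuantumFields.BalabanUV.T4Continuum.Support.NE7IteratedAverageSegment
import HarnessLib

/-!
# NE7PairTransport — TRANSPORT OF THE RATIO OF TWO PAIR GAUGES (F316): along a bond, along a straight run, along a box path; the CORNER
# CONSISTENCY of a pair gauge from the corner-segment data (`‖U′(Γ) − U_s(Γ)‖ ≤ S` on the top corner segments); the glue step's distance to the running gauge

Cell `pub-balaban`, sub-cell t4, lineage `b2b-balaban-t4-ne7-p1` (CRUX PROVER NE7 #1 = OWNER of row NE7), gen 94; memo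
`t4/b2b-balaban-t4-ne7-p1-g94/PAIR-REP-ROAD.md` §4.  Sequel of F315 `NE7PairGlueStep`.  Setting: a background `U_s` and a configuration `U′` (both with
values in the unitary group of a C⋆-algebra), site gauges `u, v`; the PAIR DEFECT of `g` at a bond `b` is `Y_g(b) = U_s(b)⁻¹(U′^{g})(b)` and `err_g(b) = ‖Y_g(b) − 1‖`;
the RATIO is `t = v u⁻¹`.
WHAT ([folklore]; 0 def, 0 sorry).  §1 one bond: `‖t(x+e_μ) − 1‖ ≤ ‖t(x) − 1‖ + err_u(b) + err_v(b)` and the backward form (F315's transport letter).  §2 a straight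
run of `m` bonds in direction `+e_μ` on which `err_u ≤ η_u`, `err_v ≤ η_v`: `‖t(x + m•e_μ) − 1‖ ≤ ‖t(x) − 1‖ + m(η_u + η_v)` and backwards.  §3 a BOX
`lo ≤ · ≤ hi` on whose bonds both gauges are good: for `p, q` in the box, `‖t(q) − 1‖ ≤ ‖t(p) − 1‖ + (Σ_i |q_i − p_i|)(η_u + η_v)` (move one coordinate at a
time; every intermediate point stays in the box).  §4 CORNER CONSISTENCY: if `err_g ≤ η` on the `M` bonds of the straight segment `Γ` from `c` in direction `e_i`
and `‖U′(Γ) − U_s(Γ)‖ ≤ S`, then `‖g(c + M•e_i) − 1‖ ≤ ‖g(c) − 1‖ + Mη + S` and `‖g(c) − 1‖ ≤ ‖g(c + M•e_i) − 1‖ + Mη + S` (gauge covariance of transport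
`U′^{g}(Γ) = g(c)U′(Γ)g(c′)⁻¹` and the telescoping `‖U′^{g}(Γ) − U_s(Γ)‖ ≤ Mη`).
HONEST FRAMING: C⋆-algebra bookkeeping; the corner-segment datum `S` is a HYPOTHESIS here (supplied at the pair by the tree's iterated-average-vs-segment letter
`NE7IteratedAverageSegment.norm_cavgIter_sub_seg_le_top` for two configurations with the SAME top average, F317); nothing of Bałaban's asserted; hleaves NOT
discharged; NE7 NOT PROVED; spine 0∕9; finite T⁴ rung (B)+1 — NOT infinite volume, NOT mass gap, NOT `BetaPertH`, NOT Clay.  Axioms ⊆ {propext, Classical.choice,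
Quot.sound}.
-/

set_option autoImplicit false

open NormedSpace
open scoped BigOperators

namespace Summit.QuantumFields.BalabanUV.T4Continuum.NE7PairTransport

open Literature.MathematicalPhysics.QuantumFieldTheory.Balaban1983to89
open MatrixLog B7Prop1Explicit B7Prop2Explicit UnitaryRootInterpolation UnitaryGeodesic NE7PairGlueStep

noncomputable section

variable {𝔸 : Type*} [CStarAlgebra 𝔸] [Nontrivial 𝔸] {d : ℕ}

/-! ## §1 One bond -/

section OneBond

variable {Us U' : Site d → Fin d → 𝔸ˣ} {u v : Site d → 𝔸ˣ}

omit [Nontrivial 𝔸] in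
/-- `‖c⁻¹ X c − 1‖ = ‖X − 1‖` for a unitary unit `c` (restated with the product bracketed as in the transport identity). [folklore] -/
theorem norm_conj_ratio_sub_one (hUs : ∀ x μ, Us x μ ∈ unitaryUnits 𝔸) (x : Site d) (μ : Fin d) (X : 𝔸ˣ) :
    ‖(((Us x μ)⁻¹ * X * Us x μ : 𝔸ˣ) : 𝔸) - 1‖ = ‖(X : 𝔸) - 1‖ :=
  norm_conj_sub_one (hUs x μ)

/-- **FORWARD STEP**: `‖t(x + e_μ) − 1‖ ≤ ‖t(x) − 1‖ + err_u(b) + err_v(b)`. [folklore] -/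
theorem norm_ratio_succ_sub_one_le (hUs : ∀ x μ, Us x μ ∈ unitaryUnits 𝔸) (hU' : ∀ x μ, U' x μ ∈ unitaryUnits 𝔸)
    (hu : ∀ x, u x ∈ unitaryUnits 𝔸) (hv : ∀ x, v x ∈ unitaryUnits 𝔸) (x : Site d) (μ : Fin d) :
    ‖((v (x + e μ) * (u (x + e μ))⁻¹ : 𝔸ˣ) : 𝔸) - 1‖
      ≤ ‖((v x * (u x)⁻¹ : 𝔸ˣ) : 𝔸) - 1‖
        + ‖(((Us x μ)⁻¹ * gaugeAct u U' x μ : 𝔸ˣ) : 𝔸) - 1‖ + ‖(((Us x μ)⁻¹ * gaugeAct v U' x μ : 𝔸ˣ) : 𝔸) - 1‖ := by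
  have h := norm_ratio_sub_conj_le hUs hU' hu hv x μ
  have hconj := norm_conj_ratio_sub_one hUs x μ (v x * (u x)⁻¹)
  calc _ = ‖(((v (x + e μ) * (u (x + e μ))⁻¹ : 𝔸ˣ) : 𝔸) - (((Us x μ)⁻¹ * (v x * (u x)⁻¹) * Us x μ : 𝔸ˣ) : 𝔸))
          + ((((Us x μ)⁻¹ * (v x * (u x)⁻¹) * Us x μ : 𝔸ˣ) : 𝔸) - 1)‖ := by rw [sub_add_sub_cancel]
    _ ≤ ‖((v (x + e μ) * (u (x + e μ))⁻¹ : 𝔸ˣ) : 𝔸) - (((Us x μ)⁻¹ * (v x * (u x)⁻¹) * Us x μ : 𝔸ˣ) : 𝔸)‖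
          + ‖(((Us x μ)⁻¹ * (v x * (u x)⁻¹) * Us x μ : 𝔸ˣ) : 𝔸) - 1‖ := norm_add_le _ _
    _ ≤ _ := by rw [hconj]; linarith

/-- **BACKWARD STEP**: `‖t(x) − 1‖ ≤ ‖t(x + e_μ) − 1‖ + err_u(b) + err_v(b)`. [folklore] -/
theorem norm_ratio_sub_one_le_succ (hUs : ∀ x μ, Us x μ ∈ unitaryUnits 𝔸) (hU' : ∀ x μ, U' x μ ∈ unitaryUnits 𝔸)
    (hu : ∀ x, u x ∈ unitaryUnits 𝔸) (hv : ∀ x, v x ∈ unitaryUnits 𝔸) (x : Site d) (μ : Fin d) :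
    ‖((v x * (u x)⁻¹ : 𝔸ˣ) : 𝔸) - 1‖
      ≤ ‖((v (x + e μ) * (u (x + e μ))⁻¹ : 𝔸ˣ) : 𝔸) - 1‖
        + ‖(((Us x μ)⁻¹ * gaugeAct u U' x μ : 𝔸ˣ) : 𝔸) - 1‖ + ‖(((Us x μ)⁻¹ * gaugeAct v U' x μ : 𝔸ˣ) : 𝔸) - 1‖ := by
  have h := norm_ratio_sub_conj_le hUs hU' hu hv x μ
  have hconj := norm_conj_ratio_sub_one hUs x μ (v x * (u x)⁻¹)
  rw [← hconj]
  calc _ = ‖((((Us x μ)⁻¹ * (v x * (u x)⁻¹) * Us x μ : 𝔸ˣ) : 𝔸) - ((v (x + e μ) * (u (x + e μ))⁻¹ : 𝔸ˣ) : 𝔸))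
          + (((v (x + e μ) * (u (x + e μ))⁻¹ : 𝔸ˣ) : 𝔸) - 1)‖ := by rw [sub_add_sub_cancel]
    _ ≤ ‖(((Us x μ)⁻¹ * (v x * (u x)⁻¹) * Us x μ : 𝔸ˣ) : 𝔸) - ((v (x + e μ) * (u (x + e μ))⁻¹ : 𝔸ˣ) : 𝔸)‖
          + ‖((v (x + e μ) * (u (x + e μ))⁻¹ : 𝔸ˣ) : 𝔸) - 1‖ := norm_add_le _ _
    _ ≤ _ := by rw [norm_sub_rev]; linarith

end OneBond

/-! ## §2 A straight run -/

section Run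

variable {Us U' : Site d → Fin d → 𝔸ˣ} {u v : Site d → 𝔸ˣ}

/-- **FORWARD RUN**: `m` bonds in direction `+e_μ` from `x`, on which `err_u ≤ η_u` and `err_v ≤ η_v`:
`‖t(x + m•e_μ) − 1‖ ≤ ‖t(x) − 1‖ + m(η_u + η_v)`. [folklore] -/
theorem norm_ratio_run_le (hUs : ∀ x μ, Us x μ ∈ unitaryUnits 𝔸) (hU' : ∀ x μ, U' x μ ∈ unitaryUnits 𝔸)
    (hu : ∀ x, u x ∈ unitaryUnits 𝔸) (hv : ∀ x, v x ∈ unitaryUnits 𝔸) (x : Site d) (μ : Fin d) {ηu ηv : ℝ} :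
    ∀ m : ℕ, (∀ j : ℕ, j < m →
        ‖(((Us (x + (j : ℤ) • e μ) μ)⁻¹ * gaugeAct u U' (x + (j : ℤ) • e μ) μ : 𝔸ˣ) : 𝔸) - 1‖ ≤ ηu ∧
        ‖(((Us (x + (j : ℤ) • e μ) μ)⁻¹ * gaugeAct v U' (x + (j : ℤ) • e μ) μ : 𝔸ˣ) : 𝔸) - 1‖ ≤ ηv) →
      ‖((v (x + (m : ℤ) • e μ) * (u (x + (m : ℤ) • e μ))⁻¹ : 𝔸ˣ) : 𝔸) - 1‖
        ≤ ‖((v x * (u x)⁻¹ : 𝔸ˣ) : 𝔸) - 1‖ + (m : ℝ) * (ηu + ηv)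
  | 0, _ => by simp
  | m + 1, h => by
      have ih := norm_ratio_run_le hUs hU' hu hv x μ m (fun j hj => h j (Nat.lt_succ_of_lt hj))
      have hm := h m (Nat.lt_succ_self m)
      have hstep := norm_ratio_succ_sub_one_le hUs hU' hu hv (x + (m : ℤ) • e μ) μ
      have hpt : x + (m : ℤ) • e μ + e μ = x + ((m + 1 : ℕ) : ℤ) • e μ := by
        rw [add_assoc, Nat.cast_succ, add_smul, one_smul]
      rw [hpt] at hstep
      calc _ ≤ ‖((v x * (u x)⁻¹ : 𝔸ˣ) : 𝔸) - 1‖ + (m : ℝ) * (ηu + ηv) + ηu + ηv := by linarith [hm.1, hm.2]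
        _ = _ := by push_cast; ring

/-- **BACKWARD RUN**: under the same data, `‖t(x) − 1‖ ≤ ‖t(x + m•e_μ) − 1‖ + m(η_u + η_v)`. [folklore] -/
theorem norm_ratio_le_run (hUs : ∀ x μ, Us x μ ∈ unitaryUnits 𝔸) (hU' : ∀ x μ, U' x μ ∈ unitaryUnits 𝔸)
    (hu : ∀ x, u x ∈ unitaryUnits 𝔸) (hv : ∀ x, v x ∈ unitaryUnits 𝔸) (x : Site d) (μ : Fin d) {ηu ηv : ℝ} :
    ∀ m : ℕ, (∀ j : ℕ, j < m →
        ‖(((Us (x + (j : ℤ) • e μ) μ)⁻¹ * gaugeAct u U' (x + (j : ℤ) • e μ) μ : 𝔸ˣ) : 𝔸) - 1‖ ≤ ηu ∧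
        ‖(((Us (x + (j : ℤ) • e μ) μ)⁻¹ * gaugeAct v U' (x + (j : ℤ) • e μ) μ : 𝔸ˣ) : 𝔸) - 1‖ ≤ ηv) →
      ‖((v x * (u x)⁻¹ : 𝔸ˣ) : 𝔸) - 1‖
        ≤ ‖((v (x + (m : ℤ) • e μ) * (u (x + (m : ℤ) • e μ))⁻¹ : 𝔸ˣ) : 𝔸) - 1‖ + (m : ℝ) * (ηu + ηv)
  | 0, _ => by simp
  | m + 1, h => by
      -- shift the base point by one bond and use the backward step at `x`
      have h0 := h 0 (Nat.succ_pos m)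
      simp only [Nat.cast_zero, zero_smul, add_zero] at h0
      have hstep := norm_ratio_sub_one_le_succ hUs hU' hu hv x μ
      have ih := norm_ratio_le_run hUs hU' hu hv (x + e μ) μ m (fun j hj => by
        have h' := h (j + 1) (Nat.succ_lt_succ hj)
        have hpt : x + ((j + 1 : ℕ) : ℤ) • e μ = x + e μ + (j : ℤ) • e μ := by
          rw [Nat.cast_succ, add_smul, one_smul, add_assoc, add_comm ((j : ℤ) • e μ)]
        rw [hpt] at h'
        exact h')
      have hpt : x + e μ + (m : ℤ) • e μ = x + ((m + 1 : ℕ) : ℤ) • e μ := by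
        rw [Nat.cast_succ, add_smul, one_smul, add_assoc, add_comm (e μ)]
      rw [hpt] at ih
      calc _ ≤ ‖((v (x + ((m + 1 : ℕ) : ℤ) • e μ) * (u (x + ((m + 1 : ℕ) : ℤ) • e μ))⁻¹ : 𝔸ˣ) : 𝔸) - 1‖
            + (m : ℝ) * (ηu + ηv) + ηu + ηv := by linarith [h0.1, h0.2]
        _ = _ := by push_cast; ring

/-- **A RUN OF INTEGER LENGTH** (both directions at once): if `err_u ≤ η_u`, `err_v ≤ η_v` on every bond `⟨y, y + e_μ⟩` with `y` on the segment between
`x` and `x + n•e_μ` (`n : ℤ`; precisely `y = x + j•e_μ`, `0 ≤ j`, `j + 1 ≤ |n|` measured from the lower end), then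
`‖t(x + n•e_μ) − 1‖ ≤ ‖t(x) − 1‖ + |n|(η_u + η_v)`.  Stated with the bond set described from the LOWER endpoint `x ⊓ (x + n e_μ)`. [folklore] -/
theorem norm_ratio_zrun_le (hUs : ∀ x μ, Us x μ ∈ unitaryUnits 𝔸) (hU' : ∀ x μ, U' x μ ∈ unitaryUnits 𝔸)
    (hu : ∀ x, u x ∈ unitaryUnits 𝔸) (hv : ∀ x, v x ∈ unitaryUnits 𝔸) (x : Site d) (μ : Fin d) (n : ℤ) {ηu ηv : ℝ}
    (hgood : ∀ j : ℕ, (j : ℤ) < |n| →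
        ‖(((Us (x + (min n 0 + j) • e μ) μ)⁻¹ * gaugeAct u U' (x + (min n 0 + j) • e μ) μ : 𝔸ˣ) : 𝔸) - 1‖ ≤ ηu ∧
        ‖(((Us (x + (min n 0 + j) • e μ) μ)⁻¹ * gaugeAct v U' (x + (min n 0 + j) • e μ) μ : 𝔸ˣ) : 𝔸) - 1‖ ≤ ηv) :
    ‖((v (x + n • e μ) * (u (x + n • e μ))⁻¹ : 𝔸ˣ) : 𝔸) - 1‖
      ≤ ‖((v x * (u x)⁻¹ : 𝔸ˣ) : 𝔸) - 1‖ + (|n| : ℝ) * (ηu + ηv) := by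
  rcases le_or_gt 0 n with hn | hn
  · -- forward run of `n.toNat` bonds from `x`
    have hmin : min n 0 = 0 := min_eq_right hn
    have habs : |n| = n := abs_of_nonneg hn
    obtain ⟨m, rfl⟩ := Int.eq_ofNat_of_zero_le hn
    have h := norm_ratio_run_le hUs hU' hu hv x μ m (fun j hj => by
      have h' := hgood j (by rw [habs]; exact_mod_cast hj)
      rw [hmin, zero_add] at h'
      exact h')
    have hcast : (|((m : ℕ) : ℤ)| : ℝ) = (m : ℝ) := by push_cast; exact abs_of_nonneg (Nat.cast_nonneg m)
    rw [hcast]; exact h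
  · -- backward run of `m` bonds from the lower end `x + n•e_μ`
    have hmin : min n 0 = n := min_eq_left hn.le
    obtain ⟨m, hm⟩ := Int.exists_eq_neg_ofNat (le_of_lt hn)
    have habs : |n| = (m : ℤ) := by rw [abs_of_neg hn, hm, neg_neg]
    have h := norm_ratio_le_run hUs hU' hu hv (x + n • e μ) μ m (fun j hj => by
      have h' := hgood j (by rw [habs]; exact_mod_cast hj)
      rw [hmin, add_smul, ← add_assoc] at h'
      exact h')
    have hpt : x + n • e μ + (m : ℤ) • e μ = x := by rw [add_assoc, ← add_smul, hm, neg_add_cancel, zero_smul, add_zero]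
    rw [hpt] at h
    have hcast : (|n| : ℝ) = (m : ℝ) := by rw [hm]; push_cast; rw [abs_neg]; exact abs_of_nonneg (Nat.cast_nonneg m)
    rw [hcast]; exact h

end Run

/-! ## §3 A box path -/

section Box

variable {Us U' : Site d → Fin d → 𝔸ˣ} {u v : Site d → 𝔸ˣ}

/-- **TRANSPORT ACROSS A BOX**: if `err_u ≤ η_u` and `err_v ≤ η_v` on every bond `⟨y, y + e_μ⟩` with `lo ≤ y`, `y + e_μ ≤ hi` (componentwise), then for
`p, q` in the box `lo ≤ · ≤ hi`: `‖t(q) − 1‖ ≤ ‖t(p) − 1‖ + (Σ_i |q_i − p_i|)(η_u + η_v)` — move the coordinates of `p` to those of `q` one at a time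
(induction on a finite set of coordinates already moved; every intermediate point lies in the box). [folklore] -/
theorem norm_ratio_box_le (hUs : ∀ x μ, Us x μ ∈ unitaryUnits 𝔸) (hU' : ∀ x μ, U' x μ ∈ unitaryUnits 𝔸)
    (hu : ∀ x, u x ∈ unitaryUnits 𝔸) (hv : ∀ x, v x ∈ unitaryUnits 𝔸) {lo hi : Site d} {ηu ηv : ℝ}
    (hgood : ∀ (y : Site d) (μ : Fin d), (∀ i, lo i ≤ y i) → (∀ i, (y + e μ) i ≤ hi i) →
        ‖(((Us y μ)⁻¹ * gaugeAct u U' y μ : 𝔸ˣ) : 𝔸) - 1‖ ≤ ηu ∧ ‖(((Us y μ)⁻¹ * gaugeAct v U' y μ : 𝔸ˣ) : 𝔸) - 1‖ ≤ ηv)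
    {p q : Site d} (hp : ∀ i, lo i ≤ p i ∧ p i ≤ hi i) (hq : ∀ i, lo i ≤ q i ∧ q i ≤ hi i) :
    ‖((v q * (u q)⁻¹ : 𝔸ˣ) : 𝔸) - 1‖ ≤ ‖((v p * (u p)⁻¹ : 𝔸ˣ) : 𝔸) - 1‖ + (∑ i, (|q i - p i| : ℝ)) * (ηu + ηv) := by
  classical
  -- the partially moved point
  let r : Finset (Fin d) → Site d := fun S i => if i ∈ S then q i else p i
  have hr_box : ∀ S i, lo i ≤ r S i ∧ r S i ≤ hi i := by
    intro S i; simp only [r]; split_ifs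
    · exact hq i
    · exact hp i
  have key : ∀ S : Finset (Fin d),
      ‖((v (r S) * (u (r S))⁻¹ : 𝔸ˣ) : 𝔸) - 1‖ ≤ ‖((v p * (u p)⁻¹ : 𝔸ˣ) : 𝔸) - 1‖ + (∑ i ∈ S, (|q i - p i| : ℝ)) * (ηu + ηv) := by
    intro S
    induction S using Finset.induction_on with
    | empty =>
        have : r ∅ = p := by funext i; simp [r]
        rw [this]; simp
    | insert i S hi ih =>
        -- move coordinate `i` from `p i` to `q i`: a run of `q i − p i` in direction `e_i` from `r S`
        have hnext : r (insert i S) = r S + (q i - p i) • e i := by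
          funext j
          simp only [r, Finset.mem_insert, Pi.add_apply, Pi.smul_apply, e_apply, smul_eq_mul]
          by_cases hji : j = i
          · subst hji; simp [hi]
          · simp [hji]
        have hrun := norm_ratio_zrun_le hUs hU' hu hv (r S) i (q i - p i) (ηu := ηu) (ηv := ηv) (fun j hj => by
          refine hgood _ i (fun l => ?_) (fun l => ?_)
          · simp only [Pi.add_apply, Pi.smul_apply, e_apply, smul_eq_mul]
            by_cases hl : l = i
            · subst hl; simp only [if_true, mul_one]
              have h1 := (hr_box S l).1; have h2 := (hp l).1; have h3 := (hq l).1
              simp only [r, hi, if_false] at h1 ⊢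
              rcases le_or_gt 0 (q l - p l) with h0 | h0
              · rw [min_eq_right h0]; linarith
              · rw [min_eq_left h0.le]; linarith
            · simp only [if_neg hl, mul_zero, add_zero]; exact (hr_box S l).1
          · simp only [Pi.add_apply, Pi.smul_apply, e_apply, smul_eq_mul]
            by_cases hl : l = i
            · subst hl; simp only [if_true, mul_one]
              have h2 := (hp l).2; have h3 := (hq l).2
              simp only [r, hi, if_false]
              rcases le_or_gt 0 (q l - p l) with h0 | h0
              · rw [min_eq_right h0]; rw [abs_of_nonneg h0] at hj; linarith
              · rw [min_eq_left h0.le]; rw [abs_of_neg h0] at hj; linarith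
            · simp only [if_neg hl, mul_zero, add_zero]; exact (hr_box S l).2)
        rw [hnext, Finset.sum_insert hi]
        have hcast : ((|q i - p i| : ℤ) : ℝ) = |((q i : ℝ) - (p i : ℝ))| := by push_cast; rfl
        calc _ ≤ ‖((v (r S) * (u (r S))⁻¹ : 𝔸ˣ) : 𝔸) - 1‖ + (|q i - p i| : ℝ) * (ηu + ηv) := by
              have := hrun; push_cast at this ⊢; exact this
          _ ≤ _ := by rw [add_mul]; linarith [ih]
  have hfin : r Finset.univ = q := by funext i; simp [r]
  have h := key Finset.univ
  rwa [hfin] at h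

end Box

/-! ## §4 Corner consistency from the corner-segment data -/

section Corner

variable {Us U' : Site d → Fin d → 𝔸ˣ} {g : Site d → 𝔸ˣ}

/-- **TELESCOPING ALONG A SEGMENT**: two unitary configurations whose bond variables differ by at most `η` on the `m` bonds of the straight segment from
`c` in direction `e_i` have segment transporters within `m·η`. [folklore] -/
theorem norm_hol_seg_sub_hol_seg_le' {V W : Site d → Fin d → 𝔸ˣ} (hV : ∀ x μ, V x μ ∈ unitaryUnits 𝔸) (hW : ∀ x μ, W x μ ∈ unitaryUnits 𝔸)
    (c : Site d) (i : Fin d) {η : ℝ} :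
    ∀ m : ℕ, (∀ j : ℕ, j < m → ‖((V (c + (j : ℤ) • e i) i : 𝔸ˣ) : 𝔸) - ((W (c + (j : ℤ) • e i) i : 𝔸ˣ) : 𝔸)‖ ≤ η) →
      ‖((hol V c (seg i (m : ℤ)) : 𝔸ˣ) : 𝔸) - ((hol W c (seg i (m : ℤ)) : 𝔸ˣ) : 𝔸)‖ ≤ (m : ℝ) * η
  | 0, _ => by simp
  | m + 1, h => by
      have ih := norm_hol_seg_sub_hol_seg_le' hV hW c i m (fun j hj => h j (Nat.lt_succ_of_lt hj))
      have hm := h m (Nat.lt_succ_self m)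
      rw [Nat.cast_succ, hol_seg_natCast_succ, hol_seg_natCast_succ, Units.val_mul, Units.val_mul]
      calc _ ≤ ‖((hol V c (seg i (m : ℤ)) : 𝔸ˣ) : 𝔸) - ((hol W c (seg i (m : ℤ)) : 𝔸ˣ) : 𝔸)‖
            + ‖((V (c + (m : ℤ) • e i) i : 𝔸ˣ) : 𝔸) - ((W (c + (m : ℤ) • e i) i : 𝔸ˣ) : 𝔸)‖ :=
            NE7IteratedAverageSegment.norm_mul_sub_mul_le' (norm_le_one_of_unitary (hV _ _))
              (norm_le_one_of_unitary (hol_mem_of hW _ _))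
        _ ≤ (m : ℝ) * η + η := add_le_add ih hm
        _ = _ := by push_cast; ring

omit [Nontrivial 𝔸] in
/-- The gauged configuration is within `err_g` of the background, bond by bond: `‖U′^{g}(b) − U_s(b)‖ = err_g(b)`. [folklore] -/
theorem norm_gaugeAct_sub_eq_err (hUs : ∀ x μ, Us x μ ∈ unitaryUnits 𝔸) (y : Site d) (μ : Fin d) :
    ‖((gaugeAct g U' y μ : 𝔸ˣ) : 𝔸) - ((Us y μ : 𝔸ˣ) : 𝔸)‖ = ‖(((Us y μ)⁻¹ * gaugeAct g U' y μ : 𝔸ˣ) : 𝔸) - 1‖ := by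
  have hid : ((gaugeAct g U' y μ : 𝔸ˣ) : 𝔸) - ((Us y μ : 𝔸ˣ) : 𝔸)
      = (Us y μ : 𝔸) * ((((Us y μ)⁻¹ * gaugeAct g U' y μ : 𝔸ˣ) : 𝔸) - 1) := by
    rw [Units.val_mul, mul_sub, mul_one, ← mul_assoc, Units.mul_inv, one_mul]
  rw [hid, CStarRing.norm_mem_unitary_mul _ (mem_unitaryUnits.mp (hUs y μ))]

/-- **CORNER CONSISTENCY, FORWARD**: if `err_g ≤ η` on the `M` bonds of the segment `Γ` from `c` in direction `e_i` and `‖U′(Γ) − U_s(Γ)‖ ≤ S`, then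
`‖g(c + M•e_i) − 1‖ ≤ ‖g(c) − 1‖ + Mη + S`. [folklore] -/
theorem norm_corner_succ_le (hUs : ∀ x μ, Us x μ ∈ unitaryUnits 𝔸) (hU' : ∀ x μ, U' x μ ∈ unitaryUnits 𝔸)
    (hg : ∀ x, g x ∈ unitaryUnits 𝔸) (c : Site d) (i : Fin d) (M : ℕ) {η S : ℝ}
    (hgood : ∀ j : ℕ, j < M → ‖(((Us (c + (j : ℤ) • e i) i)⁻¹ * gaugeAct g U' (c + (j : ℤ) • e i) i : 𝔸ˣ) : 𝔸) - 1‖ ≤ η)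
    (hS : ‖((hol U' c (seg i (M : ℤ)) : 𝔸ˣ) : 𝔸) - ((hol Us c (seg i (M : ℤ)) : 𝔸ˣ) : 𝔸)‖ ≤ S) :
    ‖((g (c + (M : ℤ) • e i) : 𝔸ˣ) : 𝔸) - 1‖ ≤ ‖((g c : 𝔸ˣ) : 𝔸) - 1‖ + (M : ℝ) * η + S := by
  set H' : 𝔸ˣ := hol U' c (seg i (M : ℤ)) with hH'
  set Hs : 𝔸ˣ := hol Us c (seg i (M : ℤ)) with hHs
  set Hg : 𝔸ˣ := hol (gaugeAct g U') c (seg i (M : ℤ)) with hHg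
  have hgU' : ∀ x μ, gaugeAct g U' x μ ∈ unitaryUnits 𝔸 := fun x μ =>
    (unitaryUnits 𝔸).mul_mem ((unitaryUnits 𝔸).mul_mem (hg x) (hU' x μ)) ((unitaryUnits 𝔸).inv_mem (hg _))
  have hH'U : H' ∈ unitaryUnits 𝔸 := hol_mem_of hU' _ _
  have hHsU : Hs ∈ unitaryUnits 𝔸 := hol_mem_of hUs _ _
  have hHgU : Hg ∈ unitaryUnits 𝔸 := hol_mem_of hgU' _ _
  -- gauge covariance: `Hg = g(c) H' g(c')⁻¹`, so `g(c') = Hg⁻¹ g(c) H'`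
  have hcov : Hg = g c * H' * (g (c + (M : ℤ) • e i))⁻¹ := by
    rw [hHg, hol_gaugeAct, disp_seg]
  have hgc' : g (c + (M : ℤ) • e i) = Hg⁻¹ * g c * H' := by rw [hcov]; group
  -- telescoping: `‖Hg − Hs‖ ≤ Mη`
  have htel : ‖(Hg : 𝔸) - (Hs : 𝔸)‖ ≤ (M : ℝ) * η :=
    norm_hol_seg_sub_hol_seg_le' hgU' hUs c i M (fun j hj => by rw [norm_gaugeAct_sub_eq_err hUs]; exact hgood j hj)
  -- `g(c') − 1 = (Hg⁻¹ − Hs⁻¹) g(c) H' + Hs⁻¹ (g(c) − 1) H' + (Hs⁻¹ H' − 1)`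
  rw [hgc', Units.val_mul, Units.val_mul]
  have hid : ((Hg⁻¹ : 𝔸ˣ) : 𝔸) * (g c : 𝔸) * (H' : 𝔸) - 1
      = (((Hg⁻¹ : 𝔸ˣ) : 𝔸) - ((Hs⁻¹ : 𝔸ˣ) : 𝔸)) * ((g c : 𝔸) * (H' : 𝔸))
        + ((Hs⁻¹ : 𝔸ˣ) : 𝔸) * (((g c : 𝔸) - 1) * (H' : 𝔸)) + (((Hs⁻¹ : 𝔸ˣ) : 𝔸) * (H' : 𝔸) - 1) := by noncomm_ring
  have hinv : ((Hg⁻¹ : 𝔸ˣ) : 𝔸) - ((Hs⁻¹ : 𝔸ˣ) : 𝔸) = ((Hg⁻¹ : 𝔸ˣ) : 𝔸) * (((Hs : 𝔸)) - (Hg : 𝔸)) * ((Hs⁻¹ : 𝔸ˣ) : 𝔸) := by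
    rw [mul_sub, sub_mul, Units.mul_inv_cancel_right, Units.inv_mul, one_mul]
  have h1 : ‖(((Hg⁻¹ : 𝔸ˣ) : 𝔸) - ((Hs⁻¹ : 𝔸ˣ) : 𝔸)) * ((g c : 𝔸) * (H' : 𝔸))‖ ≤ (M : ℝ) * η := by
    have hgH : (g c : 𝔸) * (H' : 𝔸) ∈ unitary 𝔸 := Submonoid.mul_mem _ (mem_unitaryUnits.mp (hg c)) (mem_unitaryUnits.mp hH'U)
    rw [CStarRing.norm_mul_mem_unitary _ hgH, hinv,
      CStarRing.norm_mul_mem_unitary _ (mem_unitaryUnits.mp ((unitaryUnits 𝔸).inv_mem hHsU)),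
      CStarRing.norm_mem_unitary_mul _ ((unitaryUnits 𝔸).inv_mem hHgU), norm_sub_rev]
    exact htel
  have h2 : ‖((Hs⁻¹ : 𝔸ˣ) : 𝔸) * (((g c : 𝔸) - 1) * (H' : 𝔸))‖ = ‖(g c : 𝔸) - 1‖ := by
    rw [CStarRing.norm_mem_unitary_mul _ ((unitaryUnits 𝔸).inv_mem hHsU), CStarRing.norm_mul_mem_unitary _ (mem_unitaryUnits.mp hH'U)]
  have h3 : ‖((Hs⁻¹ : 𝔸ˣ) : 𝔸) * (H' : 𝔸) - 1‖ ≤ S := by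
    have : ((Hs⁻¹ : 𝔸ˣ) : 𝔸) * (H' : 𝔸) - 1 = ((Hs⁻¹ : 𝔸ˣ) : 𝔸) * ((H' : 𝔸) - Hs) := by rw [mul_sub, Units.inv_mul]
    rw [this, CStarRing.norm_mem_unitary_mul _ ((unitaryUnits 𝔸).inv_mem hHsU)]
    exact hS
  rw [hid]
  calc _ ≤ ‖(((Hg⁻¹ : 𝔸ˣ) : 𝔸) - ((Hs⁻¹ : 𝔸ˣ) : 𝔸)) * ((g c : 𝔸) * (H' : 𝔸)) + ((Hs⁻¹ : 𝔸ˣ) : 𝔸) * (((g c : 𝔸) - 1) * (H' : 𝔸))‖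
        + ‖((Hs⁻¹ : 𝔸ˣ) : 𝔸) * (H' : 𝔸) - 1‖ := norm_add_le _ _
    _ ≤ (‖(((Hg⁻¹ : 𝔸ˣ) : 𝔸) - ((Hs⁻¹ : 𝔸ˣ) : 𝔸)) * ((g c : 𝔸) * (H' : 𝔸))‖ + ‖((Hs⁻¹ : 𝔸ˣ) : 𝔸) * (((g c : 𝔸) - 1) * (H' : 𝔸))‖)
        + ‖((Hs⁻¹ : 𝔸ˣ) : 𝔸) * (H' : 𝔸) - 1‖ := by gcongr; exact norm_add_le _ _
    _ ≤ _ := by rw [h2]; linarith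

/-- **CORNER CONSISTENCY, BACKWARD**: under the same data, `‖g(c) − 1‖ ≤ ‖g(c + M•e_i) − 1‖ + Mη + S`. [folklore] -/
theorem norm_corner_le_succ (hUs : ∀ x μ, Us x μ ∈ unitaryUnits 𝔸) (hU' : ∀ x μ, U' x μ ∈ unitaryUnits 𝔸)
    (hg : ∀ x, g x ∈ unitaryUnits 𝔸) (c : Site d) (i : Fin d) (M : ℕ) {η S : ℝ}
    (hgood : ∀ j : ℕ, j < M → ‖(((Us (c + (j : ℤ) • e i) i)⁻¹ * gaugeAct g U' (c + (j : ℤ) • e i) i : 𝔸ˣ) : 𝔸) - 1‖ ≤ η)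
    (hS : ‖((hol U' c (seg i (M : ℤ)) : 𝔸ˣ) : 𝔸) - ((hol Us c (seg i (M : ℤ)) : 𝔸ˣ) : 𝔸)‖ ≤ S) :
    ‖((g c : 𝔸ˣ) : 𝔸) - 1‖ ≤ ‖((g (c + (M : ℤ) • e i) : 𝔸ˣ) : 𝔸) - 1‖ + (M : ℝ) * η + S := by
  set H' : 𝔸ˣ := hol U' c (seg i (M : ℤ)) with hH'
  set Hs : 𝔸ˣ := hol Us c (seg i (M : ℤ)) with hHs
  set Hg : 𝔸ˣ := hol (gaugeAct g U') c (seg i (M : ℤ)) with hHg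
  have hgU' : ∀ x μ, gaugeAct g U' x μ ∈ unitaryUnits 𝔸 := fun x μ =>
    (unitaryUnits 𝔸).mul_mem ((unitaryUnits 𝔸).mul_mem (hg x) (hU' x μ)) ((unitaryUnits 𝔸).inv_mem (hg _))
  have hH'U : H' ∈ unitaryUnits 𝔸 := hol_mem_of hU' _ _
  have hHsU : Hs ∈ unitaryUnits 𝔸 := hol_mem_of hUs _ _
  have hHgU : Hg ∈ unitaryUnits 𝔸 := hol_mem_of hgU' _ _
  have hcov : Hg = g c * H' * (g (c + (M : ℤ) • e i))⁻¹ := by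
    rw [hHg, hol_gaugeAct, disp_seg]
  -- `g(c) = Hg g(c') H'⁻¹`
  have hgc : g c = Hg * g (c + (M : ℤ) • e i) * H'⁻¹ := by rw [hcov]; group
  have htel : ‖(Hg : 𝔸) - (Hs : 𝔸)‖ ≤ (M : ℝ) * η :=
    norm_hol_seg_sub_hol_seg_le' hgU' hUs c i M (fun j hj => by rw [norm_gaugeAct_sub_eq_err hUs]; exact hgood j hj)
  set g' : 𝔸ˣ := g (c + (M : ℤ) • e i) with hg'
  rw [hgc, Units.val_mul, Units.val_mul]
  have hid : (Hg : 𝔸) * (g' : 𝔸) * ((H'⁻¹ : 𝔸ˣ) : 𝔸) - 1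
      = ((Hg : 𝔸) - Hs) * ((g' : 𝔸) * ((H'⁻¹ : 𝔸ˣ) : 𝔸)) + (Hs : 𝔸) * (((g' : 𝔸) - 1) * ((H'⁻¹ : 𝔸ˣ) : 𝔸))
        + ((Hs : 𝔸) * ((H'⁻¹ : 𝔸ˣ) : 𝔸) - 1) := by noncomm_ring
  have h1 : ‖((Hg : 𝔸) - Hs) * ((g' : 𝔸) * ((H'⁻¹ : 𝔸ˣ) : 𝔸))‖ ≤ (M : ℝ) * η := by
    have hgH : (g' : 𝔸) * ((H'⁻¹ : 𝔸ˣ) : 𝔸) ∈ unitary 𝔸 :=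
      Submonoid.mul_mem _ (mem_unitaryUnits.mp (hg _)) (mem_unitaryUnits.mp ((unitaryUnits 𝔸).inv_mem hH'U))
    rw [CStarRing.norm_mul_mem_unitary _ hgH]; exact htel
  have h2 : ‖(Hs : 𝔸) * (((g' : 𝔸) - 1) * ((H'⁻¹ : 𝔸ˣ) : 𝔸))‖ = ‖(g' : 𝔸) - 1‖ := by
    rw [CStarRing.norm_mem_unitary_mul _ (mem_unitaryUnits.mp hHsU),
      CStarRing.norm_mul_mem_unitary _ (mem_unitaryUnits.mp ((unitaryUnits 𝔸).inv_mem hH'U))]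
  have h3 : ‖(Hs : 𝔸) * ((H'⁻¹ : 𝔸ˣ) : 𝔸) - 1‖ ≤ S := by
    have : (Hs : 𝔸) * ((H'⁻¹ : 𝔸ˣ) : 𝔸) - 1 = ((Hs : 𝔸) - H') * ((H'⁻¹ : 𝔸ˣ) : 𝔸) := by rw [sub_mul, Units.mul_inv]
    rw [this, CStarRing.norm_mul_mem_unitary _ (mem_unitaryUnits.mp ((unitaryUnits 𝔸).inv_mem hH'U)), norm_sub_rev]
    exact hS
  rw [hid]
  calc _ ≤ ‖((Hg : 𝔸) - Hs) * ((g' : 𝔸) * ((H'⁻¹ : 𝔸ˣ) : 𝔸)) + (Hs : 𝔸) * (((g' : 𝔸) - 1) * ((H'⁻¹ : 𝔸ˣ) : 𝔸))‖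
        + ‖(Hs : 𝔸) * ((H'⁻¹ : 𝔸ˣ) : 𝔸) - 1‖ := norm_add_le _ _
    _ ≤ (‖((Hg : 𝔸) - Hs) * ((g' : 𝔸) * ((H'⁻¹ : 𝔸ˣ) : 𝔸))‖ + ‖(Hs : 𝔸) * (((g' : 𝔸) - 1) * ((H'⁻¹ : 𝔸ˣ) : 𝔸))‖)
        + ‖(Hs : 𝔸) * ((H'⁻¹ : 𝔸ˣ) : 𝔸) - 1‖ := by gcongr; exact norm_add_le _ _
    _ ≤ _ := by rw [h2]; linarith

end Corner

end

end Summit.QuantumFields.BalabanUV.T4Continuum.NE7PairTransport
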